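import Mathlib
import HarnessLib
import Literature.MathematicalPhysics.StatisticalMechanics.InitialActivityHamiltonian
import Literature.MathematicalPhysics.StatisticalMechanics.PolymerProductDifference
import Literature.MathematicalPhysics.StatisticalMechanics.RenormalisationMapSmallness

/-!
# [ABKM19] Lemma 12.2 (`j₂ ∈ {0, 1}`) in Lipschitz form: the weak norm of `K̂_0(𝒦, ℋ) = e^{−ℋ}𝒦`
# at scale `0` and its Lipschitz dependence on the relevant seed `ℋ`

Continuation of `InitialActivityHamiltonian.lean`.  For the torus data of the tree
(`abkmNormParams`, weight tower `abkmWeightData` with `AbkmWeightBounds`, `h² ≥ h₀²`) and a complex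
perturbation `𝒦` with `‖D^s𝒦(z)‖ ≤ ρe^{|z|²/4}` (`s ≤ r₀`):

* **`weakNormLE_initKH`** — `‖K̂_0(𝒦,ℋ)‖_0^{(A)} ≤ e^{1/4}ρe^{𝔥₀}A` for `‖ℋ‖_{0,0} ≤ ⅛`, when
  `e^{1/4}ρe^{𝔥₀}A ≤ 1` ([ABKM19] (12.9) with `j₂ = 0`, `C_0 = 1`): on a connected polymer,
  `|e^{−ℋ(X)}∏𝒦|_{T_φ} ≤ (e^{1/4})^{|X|}W_0^X · (ρe^{𝔥₀})^{|X|}w_{-1:0}^X ≤ (e^{1/4}ρe^{𝔥₀})^{|X|}w_0^X`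
  by Lemma 9.3 on the blocks (`tayNormLE_expNegH_strong_abkm`, `tayNormLE_bprod`), Lemma 12.3
  (`tayNorm_initK_le`) and the scale-`0` weight inequality (`exp_quarter_mul_expWeight_le_weight_zero`);
* **`weakNormLE_initKH_sub`** — `‖K̂_0(𝒦,ℋ) − K̂_0(𝒦,ℋ')‖_0^{(A)} ≤ 16e^{3/8}ρe^{𝔥₀}A ‖ℋ − ℋ'‖_{0,0}`
  for `‖ℋ‖_{0,0}, ‖ℋ'‖_{0,0} ≤ 1/16`, when `(e^{1/4} + 2e^{3/8})ρe^{𝔥₀}A ≤ ½` ((12.9) with `j₂ = 1`, by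
  the Lipschitz bound of Lemma 9.3, `tayNormLE_expNegH_sub_strong_abkm`, and
  `tayNormLE_bprod_sub_bprod`).

Here `𝔥₀ = fieldWt h L d 0` (`= h`) and the coefficient norm is taken at `(𝔥₀, L^0, L^0)`, the
parameters of `HamSpace` at scale `0`.  Everything is proved; no named fact.  The bundled forms
(hypotheses `hy₀`, `hm` of `RGFlow.exists_isTunedQ_initial_eq`) are in
`InitialActivityHamiltonianBundled.lean`.

## References
* S. Adams, S. Buchholz, R. Kotecký, S. Müller, arXiv:1910.13564, Lemma 12.2 (12.9)–(12.10),
  Lemma 12.3, Lemma 12.5, Lemma 9.3 [AdamsBuchholzKoteckyMuller2019].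
-/

noncomputable section

namespace Literature.MathematicalPhysics.StatisticalMechanics.GradientRG

open scoped BigOperators Classical
open Finset Matrix
open Literature.MathematicalPhysics.StatisticalMechanics.TorusPolymer
  (IsPolymer blocks bprod blockOf thicken numBlocks mem_blocks subset_thicken thicken_mono
    isPolymer_empty card_blocks_eq_numBlocks)
open Literature.Barriers.CriticalPhenomena.LongRangePhi4.Polymer (IsConn)
open Literature.MathematicalPhysics.StatisticalMechanics.GradientFRD (iterDiff)
open Literature.MathematicalPhysics.QuantumFieldTheory

variable {d M : ℕ} [NeZero M]
/-! ## The weak norm of `K̂_0(𝒦, ℋ)` at scale `0` ([ABKM19] Lemma 12.2, `j₂ = 0`) -/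

/-- **[ABKM19] Lemma 12.2 (`j₁ = j₂ = 0`) for the torus data, complex `𝒦`.**  Let
`P = abkmNormParams …` with weight tower `AbkmWeightBounds` (`h² ≥ h₀²`, `δ₀, δ₁ > 0`, `A > 0`),
`d ≥ 2`, `L` odd, `M = L^N`, `⌊d/2⌋+1 ≤ p`, `⌊d/2⌋+1 ≤ M_ord`; let `𝒦` be `C^{r₀}` with
`‖D^s𝒦(z)‖ ≤ ρe^{|z|²/4}` (`s ≤ r₀`), and `‖ℋ‖_{0,0} ≤ ⅛` (coefficient norm at `(𝔥_0, L^0, L^0)`).  If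
`e^{1/4}ρe^{𝔥_0}A ≤ 1` then `‖K̂_0(𝒦, ℋ)‖_0^{(A)} ≤ e^{1/4}ρe^{𝔥_0}A`: on a connected polymer `X`,
`|e^{−ℋ(X)}∏𝒦(∇φ(x))|_{T_φ} ≤ ∏_{x}|e^{−ℋ({x})}|_{T_φ}·|∏𝒦|_{T_φ} ≤ (e^{1/4})^{|X|}W_0^X · (ρe^{𝔥_0})^{|X|}e^{¼Σ|∇φ|²}`
`≤ (e^{1/4}ρe^{𝔥_0})^{|X|} w_0^X(φ)` (Lemma 9.3, Lemma 12.3, and `w_{-1:0}^X W_0^X ≤ w_0^X`).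
[cite: AdamsBuchholzKoteckyMuller2019, Lemma 12.2 (12.9)] -/
theorem weakNormLE_initKH {L N Mord R n p r₀ : ℕ} {θbar lam μ δ₁ δ₀ A𝒫 h A : ℝ}
    {𝒞 : ℕ → (Fin d → ZMod M) → ℝ} (hd : 2 ≤ d) (hLodd : Odd L) (hM : M = L ^ N)
    (hp : d / 2 + 1 ≤ p) (hMord : d / 2 + 1 ≤ Mord)
    (hB : AbkmWeightBounds L N Mord R n θbar lam μ δ₁ δ₀ A𝒫 𝒞
      (abkmWeightData L N Mord R θbar (schedDelta δ₀ δ₁ N) 𝒞))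
    (hδ₀ : 0 < δ₀) (hδ₁ : 0 < δ₁) (hh : 0 < h) (hh0 : hZeroSq d R δ₀ δ₁ ≤ h ^ 2) (hA : 0 < A)
    {𝒦 : (Fin d → ℝ) → ℂ} {ρ : ℝ} (h𝒦 : ContDiff ℝ r₀ 𝒦)
    (h𝒦b : ∀ k, k ≤ r₀ → ∀ z : Fin d → ℝ, ‖iteratedFDeriv ℝ k 𝒦 z‖ ≤ ρ * Real.exp ((∑ i, z i ^ 2) / 4))
    {H : RelevantHamiltonian ℂ d}
    (hH : hamNorm (fieldWt h (L : ℝ) d 0) ((L : ℝ) ^ 0) (L ^ (d * 0)) H ≤ 1 / 8)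
    (hsmall : Real.exp (1 / 4) * (ρ * Real.exp (fieldWt h (L : ℝ) d 0 / (L : ℝ) ^ 0)) * A ≤ 1) :
    WeakNormLE (abkmNormParams L N Mord R p r₀ h θbar A (schedDelta δ₀ δ₁ N) 𝒞) 0 (initKH 𝒦 H)
      (Real.exp (1 / 4) * (ρ * Real.exp (fieldWt h (L : ℝ) d 0 / (L : ℝ) ^ 0)) * A) := by
  set P := abkmNormParams L N Mord R p r₀ h θbar A (schedDelta δ₀ δ₁ N) 𝒞 with hP
  set W := abkmWeightData L N Mord R θbar (schedDelta δ₀ δ₁ N) 𝒞 with hW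
  set e := ρ * Real.exp (fieldWt h (L : ℝ) d 0 / (L : ℝ) ^ 0) with he
  have hL0 : (0 : ℝ) < L := by exact_mod_cast hLodd.pos
  have h𝔥 : 0 < fieldWt h (L : ℝ) d 0 := fieldWt_pos hh hL0 d 0
  have hR0 : (0 : ℝ) < (L : ℝ) ^ 0 := by positivity
  have hp1 : 1 ≤ p := le_trans (by omega) hp
  have hρ : 0 ≤ ρ := by
    have h0 := (norm_nonneg _).trans (h𝒦b 0 (Nat.zero_le _) 0)
    exact (mul_nonneg_iff_of_pos_right (Real.exp_pos _)).1 h0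
  have he0 : 0 ≤ e := mul_nonneg hρ (Real.exp_pos _).le
  have hMt : M = L ^ 0 * L ^ N := by rw [pow_zero, one_mul]; exact hM
  have hsodd : Odd (L ^ 0) := hLodd.pow
  have htodd : Odd (L ^ N) := hLodd.pow
  -- the strong family `G_k^X = g_k M_k^{χ_X}` and its domination (Lemma 7.6 (ii))
  set G : ℕ → Finset (Fin d → ZMod M) → Matrix (Fin d → ZMod M) (Fin d → ZMod M) ℝ :=
    fun j Y => strongCoef h N j • derivForm (L : ℝ) j (diffIndex d Mord)
      (boxDensity (boxRad R L j) (boxWt (L : ℝ) d j) Y) with hG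
  have hGs : W.StrongDominated G fun _ X Y => Disjoint X Y :=
    hB.strong (diffIndex d Mord) (fun α hα => hα) (strongCoef h N) (strongCoef_le hδ₀ hδ₁ hh hh0)
  intro X hX hXc
  have hX' : IsPolymer (L ^ 0) X := hX
  have hm : 1 ≤ X.card := Finset.card_pos.2 hXc.1
  have hcard : ∀ x : Fin d → ZMod M, (blockOf (L ^ 0) x).card = L ^ (d * 0) := fun x => by
    rw [TorusPolymer.card_blockOf hMt hsodd htodd x, ← pow_mul, mul_comm]
  have hgauge : ∀ Y ⊆ X, ∀ ξ, ‖P.gauge 0 Y ξ‖ ≤ ‖P.gauge 0 X ξ‖ := fun Y hY ξ =>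
    norm_fieldGauge_mono_set _ _ _ (thicken_mono _ hY) ξ
  -- the Boltzmann factor on the blocks (Lemma 9.3)
  have hF : ∀ B ∈ blocks (L ^ 0) X,
      TayNormLE (P.gauge 0 B) r₀ (expWeight (G 0 B)) (expNegH H B) (Real.exp (1 / 4)) := by
    intro B hBm
    obtain ⟨x, -, rfl⟩ := mem_blocks.1 hBm
    have hH' : hamNorm (fieldWt h (L : ℝ) d 0) ((L : ℝ) ^ 0) (blockOf (L ^ 0) x).card H ≤ 1 / 8 := by
      rw [hcard x]; exact hH
    exact tayNormLE_expNegH_strong_abkm (R := R) (N := N) (Mord := Mord) hd hLodd hM (Nat.zero_le N) hh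
      hMord hp (subset_thicken (P.rad 0) (blockOf (L ^ 0) x)) r₀ hH'
  have hFd : ∀ B ∈ blocks (L ^ 0) X, ContDiff ℝ r₀ (expNegH H B) := fun B _ =>
    (contDiff_eval H B (n := r₀)).neg.cexp
  have hFloc : ∀ B ∈ blocks (L ^ 0) X, IsGaugeLocal (P.gauge 0 B) (expNegH H B) := fun B _ =>
    isGaugeLocal_cexp_neg_eval h𝔥.ne' hR0.ne' hp (subset_thicken _ _) H
  have hleb : ∀ B ∈ blocks (L ^ 0) X, ∀ ξ, ‖P.gauge 0 B ξ‖ ≤ ‖P.gauge 0 X ξ‖ := fun B hBm =>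
    hgauge B (hX'.subset_of_mem_blocks hBm)
  have ha : ∀ B ∈ blocks (L ^ 0) X, (0 : ℝ) ≤ Real.exp (1 / 4) := fun _ _ => (Real.exp_pos _).le
  have h1 := tayNormLE_bprod (L ^ 0) (P.gauge 0 X) (fun B => P.gauge 0 B) X hF hleb hFd hFloc ha
  have hKeq : (fun φ : (Fin d → ZMod M) → ℝ => bprod (L ^ 0) (fun B => expNegH H B φ) X) = expNegH H X :=
    funext fun φ => bprod_cexp_neg_eval H hX' φ
  have hWeq : (fun φ : (Fin d → ZMod M) → ℝ => ∏ B ∈ blocks (L ^ 0) X, expWeight (G 0 B) φ) =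
      expWeight (G 0 X) :=
    funext fun φ => prod_expWeight_blocks hGs 0 (L ^ 0) hX' φ
  have hCeq : ∏ _B ∈ blocks (L ^ 0) X, Real.exp (1 / 4) = Real.exp (1 / 4) ^ X.card := by
    rw [Finset.prod_const, card_blocks_pow_zero]
  rw [hKeq, hWeq, hCeq] at h1
  -- the initial activity (Lemma 12.3)
  have h2 : TayNormLE (P.gauge 0 X) r₀ (fun φ => Real.exp ((∑ x ∈ X, ∑ i, (gradAt x φ i) ^ 2) / 4))
      (initK 𝒦 X) (e ^ X.card) := fun φ =>
    tayNorm_initK_le h𝒦 h𝒦b h𝔥 hR0 hp1 (subset_thicken (starRad R L d 0) X) φ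
  -- the product (Lemma 12.5: `w_{-1:0}^X W_0^X ≤ w_0^X`)
  have hXd : ContDiff ℝ r₀ (expNegH H X) := (contDiff_eval H X (n := r₀)).neg.cexp
  have hXloc : IsGaugeLocal (P.gauge 0 X) (expNegH H X) :=
    isGaugeLocal_cexp_neg_eval h𝔥.ne' hR0.ne' hp (subset_thicken _ _) H
  have hKd : ContDiff ℝ r₀ (initK 𝒦 X) := contDiff_initK h𝒦 X
  have hKloc : IsGaugeLocal (P.gauge 0 X) (initK 𝒦 X) := isGaugeLocal_initK 𝒦 h𝔥 hR0 hp1 (subset_thicken _ _)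
  have hw : ∀ φ, expWeight (G 0 X) φ * Real.exp ((∑ x ∈ X, ∑ i, (gradAt x φ i) ^ 2) / 4) ≤ W.weight 0 X φ := by
    intro φ
    rw [mul_comm]
    exact exp_quarter_mul_expWeight_le_weight_zero (strongCoef_le hδ₀ hδ₁ hh hh0 0) X φ
  have h3 := TayNormLE.mul (T := P.gauge 0 X) (w := W.weight 0 X) h1 h2 (fun ξ => le_rfl) (fun ξ => le_rfl)
    hXd hKd hXloc hKloc (pow_nonneg (Real.exp_pos _).le _) (pow_nonneg he0 _) hw
  have hfun : expNegH H X * initK 𝒦 X = initKH 𝒦 H X := rfl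
  rw [hfun] at h3
  refine h3.mono ?_ fun φ => (W.weight_pos 0 X φ).le
  -- the constant: `(e^{1/4}e)^{|X|} ≤ e^{1/4}eA · A^{−|X|}` since `e^{1/4}eA ≤ 1`
  have haF : P.aFactor 0 X = (A ^ X.card)⁻¹ := by
    show (A ^ numBlocks (L ^ 0) X)⁻¹ = _
    rw [numBlocks_pow_zero]
  rw [haF, ← mul_pow, ← div_eq_mul_inv, le_div_iff₀ (pow_pos hA _), ← mul_pow]
  have hy0 : 0 ≤ Real.exp (1 / 4) * e * A := mul_nonneg (mul_nonneg (Real.exp_pos _).le he0) hA.le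
  exact pow_le_of_le_one hy0 hsmall (by omega)

/-- **[ABKM19] Lemma 12.2 (`j₁ = 0`, `j₂ = 1`) for the torus data, Lipschitz form.**  Under the
hypotheses of `weakNormLE_initKH`, for `‖ℋ‖_{0,0}, ‖ℋ'‖_{0,0} ≤ 1/16` and
`(e^{1/4} + 2e^{3/8})ρe^{𝔥_0}A ≤ ½`:
`‖K̂_0(𝒦, ℋ) − K̂_0(𝒦, ℋ')‖_0^{(A)} ≤ 16e^{3/8}ρe^{𝔥_0}A · ‖ℋ − ℋ'‖_{0,0}` — on a connected polymer
`X` the difference of the Boltzmann products is bounded by `((a+δ)^{|X|} − a^{|X|})W_0^X`,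
`a = e^{1/4}`, `δ = 16e^{3/8}‖ℋ − ℋ'‖_{0,0}` (Lemma 9.3, `DE`), times `(ρe^{𝔥_0})^{|X|}w_{-1:0}^X`.
[cite: AdamsBuchholzKoteckyMuller2019, Lemma 12.2 (12.9)] -/
theorem weakNormLE_initKH_sub {L N Mord R n p r₀ : ℕ} {θbar lam μ δ₁ δ₀ A𝒫 h A : ℝ}
    {𝒞 : ℕ → (Fin d → ZMod M) → ℝ} (hd : 2 ≤ d) (hLodd : Odd L) (hM : M = L ^ N)
    (hp : d / 2 + 1 ≤ p) (hMord : d / 2 + 1 ≤ Mord)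
    (hB : AbkmWeightBounds L N Mord R n θbar lam μ δ₁ δ₀ A𝒫 𝒞
      (abkmWeightData L N Mord R θbar (schedDelta δ₀ δ₁ N) 𝒞))
    (hδ₀ : 0 < δ₀) (hδ₁ : 0 < δ₁) (hh : 0 < h) (hh0 : hZeroSq d R δ₀ δ₁ ≤ h ^ 2) (hA : 0 < A)
    {𝒦 : (Fin d → ℝ) → ℂ} {ρ : ℝ} (h𝒦 : ContDiff ℝ r₀ 𝒦)
    (h𝒦b : ∀ k, k ≤ r₀ → ∀ z : Fin d → ℝ, ‖iteratedFDeriv ℝ k 𝒦 z‖ ≤ ρ * Real.exp ((∑ i, z i ^ 2) / 4))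
    {H H' : RelevantHamiltonian ℂ d}
    (hH : hamNorm (fieldWt h (L : ℝ) d 0) ((L : ℝ) ^ 0) (L ^ (d * 0)) H ≤ 1 / 16)
    (hH' : hamNorm (fieldWt h (L : ℝ) d 0) ((L : ℝ) ^ 0) (L ^ (d * 0)) H' ≤ 1 / 16)
    (hsmall : (Real.exp (1 / 4) + 2 * Real.exp (3 / 8)) *
      (ρ * Real.exp (fieldWt h (L : ℝ) d 0 / (L : ℝ) ^ 0)) * A ≤ 1 / 2) :
    WeakNormLE (abkmNormParams L N Mord R p r₀ h θbar A (schedDelta δ₀ δ₁ N) 𝒞) 0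
      (initKH 𝒦 H - initKH 𝒦 H')
      (16 * Real.exp (3 / 8) * (ρ * Real.exp (fieldWt h (L : ℝ) d 0 / (L : ℝ) ^ 0)) * A *
        hamNorm (fieldWt h (L : ℝ) d 0) ((L : ℝ) ^ 0) (L ^ (d * 0)) (H - H')) := by
  set P := abkmNormParams L N Mord R p r₀ h θbar A (schedDelta δ₀ δ₁ N) 𝒞 with hP
  set W := abkmWeightData L N Mord R θbar (schedDelta δ₀ δ₁ N) 𝒞 with hW
  set e := ρ * Real.exp (fieldWt h (L : ℝ) d 0 / (L : ℝ) ^ 0) with he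
  set t := hamNorm (fieldWt h (L : ℝ) d 0) ((L : ℝ) ^ 0) (L ^ (d * 0)) (H - H') with htdef
  have hL0 : (0 : ℝ) < L := by exact_mod_cast hLodd.pos
  have h𝔥 : 0 < fieldWt h (L : ℝ) d 0 := fieldWt_pos hh hL0 d 0
  have hR0 : (0 : ℝ) < (L : ℝ) ^ 0 := by positivity
  have hp1 : 1 ≤ p := le_trans (by omega) hp
  have hρ : 0 ≤ ρ := by
    have h0 := (norm_nonneg _).trans (h𝒦b 0 (Nat.zero_le _) 0)
    exact (mul_nonneg_iff_of_pos_right (Real.exp_pos _)).1 h0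
  have he0 : 0 ≤ e := mul_nonneg hρ (Real.exp_pos _).le
  have hMt : M = L ^ 0 * L ^ N := by rw [pow_zero, one_mul]; exact hM
  have hsodd : Odd (L ^ 0) := hLodd.pow
  have htodd : Odd (L ^ N) := hLodd.pow
  -- `0 ≤ t ≤ ⅛`
  have ht0 : 0 ≤ t := hamNorm_nonneg h𝔥.le hR0.le _ _
  have ht8 : t ≤ 1 / 8 := by
    have h1 := hamNorm_add_le h𝔥.le hR0.le (L ^ (d * 0)) H (-H')
    rw [← sub_eq_add_neg, hamNorm_neg] at h1
    linarith
  set a := Real.exp (1 / 4) with hadef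
  set δ := 16 * Real.exp (3 / 8) * t with hδdef
  have ha0 : 0 ≤ a := (Real.exp_pos _).le
  have hδ0 : 0 ≤ δ := by positivity
  have haδ : a + δ ≤ Real.exp (1 / 4) + 2 * Real.exp (3 / 8) := by
    have : δ ≤ 2 * Real.exp (3 / 8) := by
      rw [hδdef]; nlinarith [Real.exp_pos (3 / 8 : ℝ)]
    linarith
  -- strong family
  set G : ℕ → Finset (Fin d → ZMod M) → Matrix (Fin d → ZMod M) (Fin d → ZMod M) ℝ :=
    fun j Y => strongCoef h N j • derivForm (L : ℝ) j (diffIndex d Mord)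
      (boxDensity (boxRad R L j) (boxWt (L : ℝ) d j) Y) with hG
  have hGs : W.StrongDominated G fun _ X Y => Disjoint X Y :=
    hB.strong (diffIndex d Mord) (fun α hα => hα) (strongCoef h N) (strongCoef_le hδ₀ hδ₁ hh hh0)
  intro X hX hXc
  have hX' : IsPolymer (L ^ 0) X := hX
  have hm : 1 ≤ X.card := Finset.card_pos.2 hXc.1
  have hcard : ∀ x : Fin d → ZMod M, (blockOf (L ^ 0) x).card = L ^ (d * 0) := fun x => by
    rw [TorusPolymer.card_blockOf hMt hsodd htodd x, ← pow_mul, mul_comm]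
  have hgauge : ∀ Y ⊆ X, ∀ ξ, ‖P.gauge 0 Y ξ‖ ≤ ‖P.gauge 0 X ξ‖ := fun Y hY ξ =>
    norm_fieldGauge_mono_set _ _ _ (thicken_mono _ hY) ξ
  -- the Boltzmann factors on the blocks: `|e^{-ℋ'(B)}| ≤ a`, `|e^{-ℋ(B)} − e^{-ℋ'(B)}| ≤ δ` (Lemma 9.3)
  have hF' : ∀ B ∈ blocks (L ^ 0) X,
      TayNormLE (P.gauge 0 B) r₀ (expWeight (G 0 B)) (expNegH H' B) a := by
    intro B hBm
    obtain ⟨x, -, rfl⟩ := mem_blocks.1 hBm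
    have hH'8 : hamNorm (fieldWt h (L : ℝ) d 0) ((L : ℝ) ^ 0) (blockOf (L ^ 0) x).card H' ≤ 1 / 8 := by
      rw [hcard x]; exact hH'.trans (by norm_num)
    exact tayNormLE_expNegH_strong_abkm (R := R) (N := N) (Mord := Mord) hd hLodd hM (Nat.zero_le N) hh
      hMord hp (subset_thicken (P.rad 0) (blockOf (L ^ 0) x)) r₀ hH'8
  have hΔ : ∀ B ∈ blocks (L ^ 0) X, TayNormLE (P.gauge 0 B) r₀ (expWeight (G 0 B))
      (fun φ => expNegH H B φ - expNegH H' B φ) δ := by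
    intro B hBm
    obtain ⟨x, -, rfl⟩ := mem_blocks.1 hBm
    have hH16 : hamNorm (fieldWt h (L : ℝ) d 0) ((L : ℝ) ^ 0) (blockOf (L ^ 0) x).card H ≤ 1 / 16 := by
      rw [hcard x]; exact hH
    have hH'16 : hamNorm (fieldWt h (L : ℝ) d 0) ((L : ℝ) ^ 0) (blockOf (L ^ 0) x).card H' ≤ 1 / 16 := by
      rw [hcard x]; exact hH'
    have := tayNormLE_expNegH_sub_strong_abkm (R := R) (N := N) (Mord := Mord) hd hLodd hM (Nat.zero_le N) hh
      hMord hp (subset_thicken (P.rad 0) (blockOf (L ^ 0) x)) r₀ hH16 hH'16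
    rw [hcard x] at this
    exact this
  have hFd : ∀ B ∈ blocks (L ^ 0) X, ContDiff ℝ r₀ (expNegH H B) := fun B _ =>
    (contDiff_eval H B (n := r₀)).neg.cexp
  have hF'd : ∀ B ∈ blocks (L ^ 0) X, ContDiff ℝ r₀ (expNegH H' B) := fun B _ =>
    (contDiff_eval H' B (n := r₀)).neg.cexp
  have hFloc : ∀ B ∈ blocks (L ^ 0) X, IsGaugeLocal (P.gauge 0 B) (expNegH H B) := fun B _ =>
    isGaugeLocal_cexp_neg_eval h𝔥.ne' hR0.ne' hp (subset_thicken _ _) H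
  have hF'loc : ∀ B ∈ blocks (L ^ 0) X, IsGaugeLocal (P.gauge 0 B) (expNegH H' B) := fun B _ =>
    isGaugeLocal_cexp_neg_eval h𝔥.ne' hR0.ne' hp (subset_thicken _ _) H'
  have hleb : ∀ B ∈ blocks (L ^ 0) X, ∀ ξ, ‖P.gauge 0 B ξ‖ ≤ ‖P.gauge 0 X ξ‖ := fun B hBm =>
    hgauge B (hX'.subset_of_mem_blocks hBm)
  have h1 := tayNormLE_bprod_sub_bprod (L ^ 0) (P.gauge 0 X) (fun B => P.gauge 0 B) hX' hF' hΔ hleb hFd hF'd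
    hFloc hF'loc (fun _ _ => ha0) (fun _ _ => hδ0)
  have hKeq : (fun φ : (Fin d → ZMod M) → ℝ => bprod (L ^ 0) (fun B => expNegH H B φ) X -
      bprod (L ^ 0) (fun B => expNegH H' B φ) X) = fun φ => expNegH H X φ - expNegH H' X φ := by
    funext φ
    have e1 : bprod (L ^ 0) (fun B => expNegH H B φ) X = expNegH H X φ := bprod_cexp_neg_eval H hX' φ
    have e2 : bprod (L ^ 0) (fun B => expNegH H' B φ) X = expNegH H' X φ := bprod_cexp_neg_eval H' hX' φ
    rw [e1, e2]
  have hWeq : (fun φ : (Fin d → ZMod M) → ℝ => ∏ B ∈ blocks (L ^ 0) X, expWeight (G 0 B) φ) =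
      expWeight (G 0 X) :=
    funext fun φ => prod_expWeight_blocks hGs 0 (L ^ 0) hX' φ
  have hCeq : (∏ _B ∈ blocks (L ^ 0) X, (a + δ)) - ∏ _B ∈ blocks (L ^ 0) X, a =
      (a + δ) ^ X.card - a ^ X.card := by
    rw [Finset.prod_const, Finset.prod_const, card_blocks_pow_zero]
  rw [hKeq, hWeq, hCeq] at h1
  -- the initial activity (Lemma 12.3)
  have h2 : TayNormLE (P.gauge 0 X) r₀ (fun φ => Real.exp ((∑ x ∈ X, ∑ i, (gradAt x φ i) ^ 2) / 4))
      (initK 𝒦 X) (e ^ X.card) := fun φ =>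
    tayNorm_initK_le h𝒦 h𝒦b h𝔥 hR0 hp1 (subset_thicken (starRad R L d 0) X) φ
  -- the product
  have hΔd : ContDiff ℝ r₀ (fun φ : (Fin d → ZMod M) → ℝ => expNegH H X φ - expNegH H' X φ) :=
    ((contDiff_eval H X (n := r₀)).neg.cexp).sub (contDiff_eval H' X (n := r₀)).neg.cexp
  have hΔloc : IsGaugeLocal (P.gauge 0 X) (fun φ : (Fin d → ZMod M) → ℝ => expNegH H X φ - expNegH H' X φ) :=
    IsGaugeLocal.op₂ _ (fun u v : ℂ => u - v) (isGaugeLocal_cexp_neg_eval h𝔥.ne' hR0.ne' hp (subset_thicken _ _) H)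
      (isGaugeLocal_cexp_neg_eval h𝔥.ne' hR0.ne' hp (subset_thicken _ _) H')
  have hKd : ContDiff ℝ r₀ (initK 𝒦 X) := contDiff_initK h𝒦 X
  have hKloc : IsGaugeLocal (P.gauge 0 X) (initK 𝒦 X) := isGaugeLocal_initK 𝒦 h𝔥 hR0 hp1 (subset_thicken _ _)
  have hw : ∀ φ, expWeight (G 0 X) φ * Real.exp ((∑ x ∈ X, ∑ i, (gradAt x φ i) ^ 2) / 4) ≤ W.weight 0 X φ := by
    intro φ
    rw [mul_comm]
    exact exp_quarter_mul_expWeight_le_weight_zero (strongCoef_le hδ₀ hδ₁ hh hh0 0) X φ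
  have hC0 : 0 ≤ (a + δ) ^ X.card - a ^ X.card :=
    sub_nonneg.2 (pow_le_pow_left₀ ha0 (le_add_of_nonneg_right hδ0) _)
  have h3 := TayNormLE.mul (T := P.gauge 0 X) (w := W.weight 0 X) h1 h2 (fun ξ => le_rfl) (fun ξ => le_rfl)
    hΔd hKd hΔloc hKloc hC0 (pow_nonneg he0 _) hw
  have hfun : (fun φ : (Fin d → ZMod M) → ℝ => expNegH H X φ - expNegH H' X φ) * initK 𝒦 X =
      (initKH 𝒦 H - initKH 𝒦 H' : Finset (Fin d → ZMod M) → ((Fin d → ZMod M) → ℝ) → ℂ) X := by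
    funext φ
    rw [Pi.mul_apply, Pi.sub_apply, Pi.sub_apply, initKH_sub]
  rw [hfun] at h3
  refine h3.mono ?_ fun φ => (W.weight_pos 0 X φ).le
  -- the constant: `((a+δ)^m − a^m)e^m ≤ δeA·A^{−m}` for `m = |X| ≥ 1` and `(a+δ)eA ≤ ½`
  have haF : P.aFactor 0 X = (A ^ X.card)⁻¹ := by
    show (A ^ numBlocks (L ^ 0) X)⁻¹ = _
    rw [numBlocks_pow_zero]
  rw [haF, ← div_eq_mul_inv, le_div_iff₀ (pow_pos hA _)]
  obtain ⟨n, hn⟩ : ∃ n, X.card = n + 1 := ⟨X.card - 1, by omega⟩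
  rw [hn]
  have hx : (a + δ) * e * A ≤ 1 / 2 :=
    (mul_le_mul_of_nonneg_right (mul_le_mul_of_nonneg_right haδ he0) hA.le).trans hsmall
  have hx0 : 0 ≤ (a + δ) * e * A := mul_nonneg (mul_nonneg (add_nonneg ha0 hδ0) he0) hA.le
  have hkey := succ_mul_pow_le_one_of_le_half hx0 hx n
  have hkey' : (n + 1 : ℝ) * ((a + δ) ^ n * e ^ n * A ^ n) ≤ 1 := by
    rw [← mul_pow, ← mul_pow]; exact hkey
  have hmv : (a + δ) ^ (n + 1) - a ^ (n + 1) ≤ (n + 1 : ℝ) * δ * (a + δ) ^ n := by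
    have h := Literature.MathematicalPhysics.StatisticalMechanics.TorusPolymer.add_pow_succ_sub_pow_succ_le
      ha0 hδ0 n
    have e : δ * ((n + 1 : ℕ) : ℝ) * (a + δ) ^ n = (n + 1 : ℝ) * δ * (a + δ) ^ n := by
      push_cast; ring
    rw [e] at h
    exact h
  calc ((a + δ) ^ (n + 1) - a ^ (n + 1)) * e ^ (n + 1) * A ^ (n + 1)
      ≤ ((n + 1 : ℝ) * δ * (a + δ) ^ n) * e ^ (n + 1) * A ^ (n + 1) :=
        mul_le_mul_of_nonneg_right (mul_le_mul_of_nonneg_right hmv (pow_nonneg he0 _)) (pow_nonneg hA.le _)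
    _ = δ * e * A * ((n + 1 : ℝ) * ((a + δ) ^ n * e ^ n * A ^ n)) := by ring
    _ ≤ δ * e * A * 1 := mul_le_mul_of_nonneg_left hkey' (by positivity)
    _ = 16 * Real.exp (3 / 8) * e * A * t := by rw [hδdef]; ring

end Literature.MathematicalPhysics.StatisticalMechanics.GradientRG

end
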